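import Summits.Langlands.Langlands.Theorems.DetTowerAccessibleAvatars

/-!
# DetTower (PART B: kernels) — lens-3-g16 node `DeterminantTowerSplit` (decomp-langlands, D-0171/D-0178)

Tree twin PART B of HOME/nodes/lens-3-g16-DeterminantTowerSplit.lean: §4 kernels over PART A
(`Summits.Langlands.Langlands.Theorems.DetTowerAccessibleAvatars`: the four item texts INT / DEPTH / TR / FRAME,
the vocabulary `Oint`/`Lam`/`lamMk` and the dictionary lemmas incl. `tower_of_framedRep`).  Proved here (0 sorry):
`depth_of_acc` (Acc ⟹ DEPTH), `int_of_acc` (Acc ⟹ INT mod `exists_hasQlModel`), `acc_of_pieces` (INT ∧ DEPTH ⟹ Acc given TR),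
THE EQUIV `acc_iff_pieces`, the necessity certificates `acc_of_langlands`, `int_of_langlands`, `depth_of_langlands`,
`frame_of_langlands`, the host certificate `frame_of_host`, the deciding theorem `closes : INT → DEPTH → TR → FRAME → Langlands`,
`assembly_holds` and the exactness statement `langlands_iff_pieces`.
-/

set_option linter.unusedVariables false
set_option linter.dupNamespace false -- project-wide option; `Summit.Langlands.Langlands` is the mandated namespace

namespace Summit.Langlands.Langlands.Theorems.DetTower

open Literature.NumberTheory.GaloisRepresentations Literature.NumberTheory.Automorphic
open IsDedekindDomain
open Summit.Langlands.Langlands.Theses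
open scoped NumberField Polynomial

/-! ## §4 Kernels -/

section Kernels

/-- **K3** `Acc ⟹ DEPTH`: the tower of the accessible avatar (`tower_of_framedRep`; the exceptional set is
the finite set where Satake–Frobenius compatibility fails; uniqueness of Satake parameters
`AutomorphicRepData.hasSatakeParamAt_unique_holds`). -/
theorem depth_of_acc (hAcc : RootDecomp1.AccessibleAvatars) : DeterminantTowerAvatars := by
  intro K _ _ n hcpt hn hK π hπ ℓ _ ι
  classical
  obtain ⟨ρ, -, hρ⟩ := hAcc K n hcpt hn hK π hπ ℓ ι
  let S : Finset (HeightOneSpectrum (𝓞 K)) := (Filter.eventually_cofinite.1 hρ).toFinset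
  have hS : ∀ v ∉ S, SatakeFrobCompatibleAt ι π.1 ρ v := fun v hv =>
    not_not.1 fun h => hv ((Set.Finite.mem_toFinset _).2 h)
  refine ⟨S, fun m _ => ?_⟩
  let Q : HeightOneSpectrum (𝓞 K) → (PadicAlgCl ℓ)[X] := fun v =>
    if h : SatakeFrobCompatibleAt ι π.1 ρ v then
      arithFrobPolyOfSatake ι v.residueCard 1 (Classical.choose h) else 0
  have hQ : ∀ v ∉ S, ρ.IsUnramifiedAt v ∧ ρ.HasFrobCharpolyAt v (Q v) := fun v hv => by
    have h := hS v hv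
    obtain ⟨-, hur, hfr⟩ := Classical.choose_spec h
    refine ⟨hur, ?_⟩
    simp only [Q, dif_pos h]
    exact hfr
  obtain ⟨D, hD, hDv⟩ := tower_of_framedRep ρ S Q hQ m
  refine ⟨D, hD, fun v hv => ⟨(hDv v hv).1, fun α hα P hP => (hDv v hv).2 P ?_⟩⟩
  have h := hS v hv
  have hαeq : α = Classical.choose h :=
    π.1.hasSatakeParamAt_unique_holds hα (Classical.choose_spec h).1
  rw [hP, hαeq]
  simp only [Q, dif_pos h]

/-- **K2** `Acc ⟹ INT` (modulo the named fact `exists_hasQlModel`, Buzzard–Gee 2014): Frobenius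
characteristic polynomials of `ρ` are `E`-rational for a model field `E` (`coeff_charpoly_mem_of_hasQlModel`)
and `ℓ`-integral (`coeff_charpoly_mem_integers`); arithmetic Frobenii exist
(`exists_isArithFrobAt_of_mem_primesAbove_holds`, `primesAbove_nonempty`, PROVED in the tree). -/
theorem int_of_acc (hQl : exists_hasQlModel.{0}) (hAcc : RootDecomp1.AccessibleAvatars) :
    IntegralFrobeniusData := by
  intro K _ _ n hcpt hn hK π hπ ℓ _ ι
  obtain ⟨ρ, -, hρ⟩ := hAcc K n hcpt hn hK π hπ ℓ ι
  obtain ⟨E, rE, hE, hmod⟩ := hQl ρ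
  refine ⟨E, hE, hρ.mono fun v hv => ?_⟩
  obtain ⟨α, hα, -, hfrob⟩ := hv
  obtain ⟨𝔓, h𝔓⟩ := v.primesAbove_nonempty
  obtain ⟨σ, hσ⟩ := HeightOneSpectrum.exists_isArithFrobAt_of_mem_primesAbove_holds h𝔓
  have hQ : FramedRep.charpoly ρ σ = arithFrobPolyOfSatake ι v.residueCard 1 α := hfrob 𝔓 h𝔓 σ hσ
  refine ⟨α, hα, fun i => ⟨?_, ?_⟩⟩
  · rw [← hQ]; exact coeff_charpoly_mem_of_hasQlModel hmod σ i
  · rw [← hQ]; exact coeff_charpoly_mem_integers ρ σ i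

/-- **K4** `INT ∧ DEPTH ⟹ Acc` given TR: the level set is `S* = S_DEPTH ∪ T` (`T` the exceptional set of
INT), the integral Frobenius polynomials are the `Polynomial.toSubring` lifts of the Satake polynomials,
the tower hypothesis of TR is DEPTH at the (unique) Satake parameter, and TR's `ρ` is the avatar. -/
theorem acc_of_pieces (hTR : TowerRealisation) (hI : IntegralFrobeniusData)
    (hD : DeterminantTowerAvatars) : RootDecomp1.AccessibleAvatars := by
  intro K _ _ n hcpt hn hK π hπ ℓ _ ι
  classical
  obtain ⟨E, hE, hIv⟩ := hI K n hcpt hn hK π hπ ℓ ι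
  obtain ⟨SD, hSD⟩ := hD K n hcpt hn hK π hπ ℓ ι
  -- the «good» places of INT and its finite exceptional set
  let Good : HeightOneSpectrum (𝓞 K) → Prop := fun v => ∃ α : Multiset ℂ, π.1.HasSatakeParamAt v α ∧
    ∀ i : ℕ, (arithFrobPolyOfSatake ι v.residueCard 1 α).coeff i ∈ E ∧
      (arithFrobPolyOfSatake ι v.residueCard 1 α).coeff i ∈
        (Valued.v : Valuation (PadicAlgCl ℓ) NNReal).valuationSubring
  let T : Finset (HeightOneSpectrum (𝓞 K)) := (Filter.eventually_cofinite.1 hIv).toFinset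
  have hT : ∀ v ∉ T, Good v := fun v hv => not_not.1 fun h => hv ((Set.Finite.mem_toFinset _).2 h)
  -- integral lifts of the Satake polynomials
  let P : HeightOneSpectrum (𝓞 K) → Polynomial ↥(Oint ℓ) := fun v =>
    if h : Good v then
      (arithFrobPolyOfSatake ι v.residueCard 1 (Classical.choose h)).toSubring (Oint ℓ).toSubring
        (coeffs_subset_of_forall_coeff_mem fun i => ((Classical.choose_spec h).2 i).2)
    else 0
  have hPmap : ∀ v (h : Good v), (P v).map (Oint ℓ).subtype =
      arithFrobPolyOfSatake ι v.residueCard 1 (Classical.choose h) := fun v h => by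
    simp only [P, dif_pos h]
    exact Polynomial.map_toSubring _ _ _
  have hPE : ∀ v (h : Good v) (i : ℕ), ((P v).coeff i : PadicAlgCl ℓ) ∈ E := fun v h i => by
    have hc := congrArg (fun p : (PadicAlgCl ℓ)[X] => p.coeff i) (hPmap v h)
    simp only [Polynomial.coeff_map] at hc
    have hc' : ((P v).coeff i : PadicAlgCl ℓ) =
        (arithFrobPolyOfSatake ι v.residueCard 1 (Classical.choose h)).coeff i := hc
    rw [hc']
    exact ((Classical.choose_spec h).2 i).1
  let S : Finset (HeightOneSpectrum (𝓞 K)) := SD ∪ T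
  have hST : ∀ v ∉ S, v ∉ T := fun v hv h => hv (Finset.mem_union_right _ h)
  have hSSD : ∀ v ∉ S, v ∉ SD := fun v hv h => hv (Finset.mem_union_left _ h)
  -- the tower hypothesis of TR is DEPTH at the Satake parameter
  have htower : ∀ m : ℕ, 0 < m → ∃ D : GaloisDeterminant K (Lam ℓ m) n,
      IsLocallyConstant (fun g : Field.absoluteGaloisGroup K => D.charpoly (MonoidAlgebra.of _ _ g)) ∧
      ∀ v ∉ S, D.IsUnramifiedAt v ∧ D.HasFrobCharpolyAt v ((P v).map (lamMk ℓ m)) := by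
    intro m hm
    obtain ⟨D, hlc, hDv⟩ := hSD m hm
    refine ⟨D, hlc, fun v hv => ⟨(hDv v (hSSD v hv)).1, ?_⟩⟩
    have hG := hT v (hST v hv)
    exact (hDv v (hSSD v hv)).2 (Classical.choose hG) (Classical.choose_spec hG).1 (P v) (hPmap v hG)
  obtain ⟨ρ, hss, hρ⟩ := hTR K n hn ℓ E hE S P (fun v hv i => hPE v (hT v (hST v hv)) i) htower
  refine ⟨ρ, hss, S.eventually_cofinite_notMem.mono fun v hv => ?_⟩
  have hG := hT v (hST v hv)
  refine ⟨Classical.choose hG, (Classical.choose_spec hG).1, (hρ v hv).1, ?_⟩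
  rw [← hPmap v hG]
  exact (hρ v hv).2

/-- **THE EQUIV (lens 3)**: modulo the print support TR and the named fact `exists_hasQlModel`,
the accessible semisimple avatar is EQUIVALENT to INT ∧ DEPTH. -/
theorem acc_iff_pieces (hTR : TowerRealisation) (hQl : exists_hasQlModel.{0}) :
    RootDecomp1.AccessibleAvatars ↔ IntegralFrobeniusData ∧ DeterminantTowerAvatars :=
  ⟨fun h => ⟨int_of_acc hQl h, depth_of_acc h⟩, fun h => acc_of_pieces hTR h.1 h.2⟩

/-! ### Necessity certificates (each piece is implied by the ROOT; nothing is credited) -/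

/-- The ROOT implies Acc (the (A)-direction of reciprocity gives an irreducible, hence semisimple,
Satake–Frobenius compatible `ρ`). -/
theorem acc_of_langlands (hL : _root_.Langlands) : RootDecomp1.AccessibleAvatars := by
  intro K _ _ n hcpt hn hK π hπ ℓ _ ι
  obtain ⟨⟨𝓡⟩, h⟩ := hL K
  obtain ⟨ρ, hirr, -, hcorr, -⟩ := (h 𝓡 n hn hcpt).1 π hπ ℓ ι
  exact ⟨ρ, isSemisimple_of_isIrreducible ρ hirr, hcorr.1⟩

/-- `Langlands ⟹ INT` (modulo `exists_hasQlModel`). -/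
theorem int_of_langlands (hQl : exists_hasQlModel.{0}) (hL : _root_.Langlands) : IntegralFrobeniusData :=
  int_of_acc hQl (acc_of_langlands hL)

/-- `Langlands ⟹ DEPTH`. -/
theorem depth_of_langlands (hL : _root_.Langlands) : DeterminantTowerAvatars :=
  depth_of_acc (acc_of_langlands hL)

/-- `Langlands ⟹ FRAME` (trivially). -/
theorem frame_of_langlands (hL : _root_.Langlands) : DeterminantTowerFrame := fun _ => hL

/-- **FRAME from the host**: the other fifteen items of route-Langlands-RootDecomp1 rev 4 (ten `closes`
binders besides E, and the five siblings G, AvDesc, RTT, AIT, DT of Acc under E) give `Acc → Langlands`,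
through the landed glue `SemisimpleAvatar_of_split_proof` and `RootDecomp1.closes`. -/
theorem frame_of_host (hB : RootDecomp1.WeakGeometricAutomorphy) (hIrr : RootDecomp1.CuspidalAvatarIrreducible)
    (hP : RootDecomp1.PadicMemberCompatibility) (hG : RootDecomp1.SatakePlacesAllData)
    (hRig : RootDecomp1.RecRigidity) (hS : RootDecomp1.SemisimpleMatchingOneDatum)
    (hGEN : RootDecomp1.GenericFibre) (hRG : RootDecomp1.RecPreservesGenericity)
    (hWDU : RootDecomp1.GenericWDUnique) (hR : RootDecomp1.CanonicalReciprocityData)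
    (hDark : RootDecomp1.DarkPrimitiveAvatars) (hDesc : RootDecomp1.AvatarDescent)
    (hRTT : RootDecomp1.RestrictionTwistTransport) (hAIT : RootDecomp1.InductionTransport)
    (hDT : RootDecomp1.DualTransport) : DeterminantTowerFrame := fun hAcc =>
  RootDecomp1.closes hB (SemisimpleAvatar_of_split_proof hDark hAcc hDesc hRTT hAIT hDT) hIrr hP hG hRig hS
    hGEN hRG hWDU hR

/-- **DECIDING THEOREM** (the route's `closes`, D-0027 §2.1): INT → DEPTH → TR → FRAME → Langlands. -/
theorem closes (hI : IntegralFrobeniusData) (hD : DeterminantTowerAvatars) (hT : TowerRealisation)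
    (hF : DeterminantTowerFrame) : _root_.Langlands :=
  hF (acc_of_pieces hT hI hD)

/-- The Assembly item holds (curried `closes`). -/
theorem assembly_holds : Assembly := fun hI hD hT hF => closes hI hD hT hF

/-- **EXACTNESS**: given TR, the named fact and FRAME, the ROOT is EQUIVALENT to INT ∧ DEPTH. -/
theorem langlands_iff_pieces (hTR : TowerRealisation) (hQl : exists_hasQlModel.{0})
    (hF : DeterminantTowerFrame) :
    _root_.Langlands ↔ IntegralFrobeniusData ∧ DeterminantTowerAvatars :=
  ⟨fun hL => ⟨int_of_langlands hQl hL, depth_of_langlands hL⟩, fun h => closes h.1 h.2 hTR hF⟩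

end Kernels

end Summit.Langlands.Langlands.Theorems.DetTower
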